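import Mathlib
import Summits.Ventures.HodgeRepro2.T5KudlaGaussSum
import Summits.Ventures.HodgeRepro2.T5DVRQuotientCard

/-!
# Kudla's Gauss sum with the SELF-DUAL measure: the general-`ν` normalisation

Blind cell `pub-hodge-repro2`, seat p7 (gen 9), Tier-5 kernel support for N5 / §G [R-4]
(route/T5-route-3.md §AA.1(b)(iii): «the general-ν form of (iii) — the self-dual measure's
`q^{−ν/2}` — has no announced kernel twin»; route/T5-LEAN-p7.md §21 / §24).

Kudla's printed Gauss sum (Prop. 3.8 (ii), as read in route/T5-CHECK-G-p7.md §4 [R-4]) is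
`𝔤(ω, ψ) = q^{½(ν+c)} ∫_{𝒪^×} ω^{−1}(y) ψ(ϖ^{−ν−c} y) dy` with `dy` the SELF-DUAL measure of `ψ`
(conductor `𝔭^{−ν}`), i.e. the Haar measure with `vol(𝒪) = q^{−ν/2}` ((3.29)).  `T5KudlaGaussSum`
(row 25) formalised the integral against a PROBABILITY Haar measure `dy₀` (`vol(𝒪) = 1`) with the
prefactor `√|𝒪/𝔭^c|`.  This file supplies the bridge:

* `selfDualScaled μ q ν := q^{−ν/2} • μ` — the scaled measure (DEFINED as such; that it is THE
  self-dual measure of a `ψ` of conductor `𝔭^{−ν}` is the reading of Kudla (3.29), prose);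
* `kudlaGaussSumSelfDual μ q ν …` — Kudla's `𝔤` with the prefactor `q^{½(ν+c)}` and the measure
  `selfDualScaled μ q ν`, `c = m + 1`;
* `kudlaGaussSumSelfDual_eq`: it EQUALS `kudlaGaussSumZ μ … (ν + c)` of row 25 whenever
  `|𝒪/𝔭^c| = q^c` — the factors `q^{½(ν+c)} · q^{−ν/2} = q^{c/2} = √|𝒪/𝔭^c|` cancel exactly
  (no residual power of `q`, as §AA.1(b)(iii) computes by hand);
* `kudlaGaussSumSelfDual_eq_gNorm` and `kudlaGaussSumSelfDual_mul_kudlaGaussSumSelfDual_inv`: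
  hence `𝔤 = gNorm(descended characters)` and `𝔤(ω)𝔤(ω⁻¹) = ω(−1)` for the self-dual
  normalisation at EVERY `ν` (rows 25 / 27), with `|𝒪/𝔭^c| = q^c` discharged from
  `T5DVRQuotientCard` when `q = |𝒪/𝔭|` (`kudlaGaussSumSelfDual_eq_of_residueField`).

README §8(d): uses an L-value-free non-vanishing device: NO.
-/

namespace Summit.Ventures.HodgeRepro2.T5SelfDualGaussSum

open MeasureTheory Ideal
open Summit.Ventures.HodgeRepro2

variable {𝒪 : Type*} [CommRing 𝒪] [IsDomain 𝒪] [IsDiscreteValuationRing 𝒪] {ϖ : 𝒪} {m : ℕ}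
  [MeasurableSpace 𝒪] (μ : Measure 𝒪)
  {K : Type*} [Field K] [Algebra 𝒪 K]

/-- The self-dual scaling of a Haar measure: `dy = q^{−ν/2} · dy₀`, i.e. `vol(𝒪) = q^{−ν/2}`
when `μ` is the probability Haar measure.  For `q = |𝒪/𝔭|` this is the self-dual measure of an
additive character of conductor `𝔭^{−ν}` (Kudla (3.29) — the identification is prose). -/
noncomputable def selfDualScaled (q : ℝ) (ν : ℕ) : Measure 𝒪 :=
  ENNReal.ofReal (Real.sqrt (q ^ ν))⁻¹ • μ

omit [CommRing 𝒪] [IsDomain 𝒪] [IsDiscreteValuationRing 𝒪] in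
/-- `vol(𝒪) = q^{−ν/2}` for the scaled measure when `μ` is a probability measure. -/
theorem selfDualScaled_univ [IsProbabilityMeasure μ] (q : ℝ) (ν : ℕ) :
    selfDualScaled μ q ν Set.univ = ENNReal.ofReal (Real.sqrt (q ^ ν))⁻¹ := by
  simp [selfDualScaled]

/-- Kudla's `𝔤(ω, ψ)` with the self-dual measure:
`q^{½(ν+c)} ∫_𝒪 ω'(ȳ) Ψ(y ϖ^{−(ν+c)}) dy`, `c = m + 1`, `dy = selfDualScaled μ q ν`
(the integrand of row 25's `kudlaGaussSumZ`, which vanishes off `𝒪^×`). -/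
noncomputable def kudlaGaussSumSelfDual (q : ℝ) (ν : ℕ)
    [Fintype (𝒪 ⧸ span {ϖ ^ (m + 1)})] (hϖ : Irreducible ϖ) (ω' : 𝒪ˣ →* ℂˣ)
    (h : T5PrincipalUnitFiltration.higherUnits ϖ (m + 1) ≤ ω'.ker) (Ψ : AddChar K ℂ) : ℂ :=
  (Real.sqrt (q ^ (ν + (m + 1))) : ℂ) *
    ∫ y, (T5CharacterDescent.descendChar hϖ ω' h) (Ideal.Quotient.mk (span {ϖ ^ (m + 1)}) y) *
      Ψ (algebraMap 𝒪 K y * algebraMap 𝒪 K ϖ ^ (-((ν + (m + 1) : ℕ) : ℤ)))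
      ∂(selfDualScaled μ q ν)

/-- The scalar identity behind the cancellation: `√(q^{ν+c}) · (√(q^ν))⁻¹ = √(q^c)`. -/
theorem sqrt_pow_add_mul_inv_sqrt_pow {q : ℝ} (hq : 0 < q) (ν c : ℕ) :
    Real.sqrt (q ^ (ν + c)) * (Real.sqrt (q ^ ν))⁻¹ = Real.sqrt (q ^ c) := by
  have h1 : 0 < Real.sqrt (q ^ ν) := Real.sqrt_pos.mpr (by positivity)
  rw [pow_add, Real.sqrt_mul (by positivity)]
  field_simp

/-- **The bridge**: Kudla's `𝔤` with the self-dual measure and the prefactor `q^{½(ν+c)}` is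
row 25's `kudlaGaussSumZ` (probability measure, prefactor `√|𝒪/𝔭^c|`) at `k = ν + c`, as soon as
`|𝒪/𝔭^c| = q^c`.  The powers of `q` cancel exactly. -/
theorem kudlaGaussSumSelfDual_eq {q : ℝ} (hq : 0 < q) (ν : ℕ)
    [Fintype (𝒪 ⧸ span {ϖ ^ (m + 1)})]
    (hcard : (Fintype.card (𝒪 ⧸ span {ϖ ^ (m + 1)}) : ℝ) = q ^ (m + 1))
    (hϖ : Irreducible ϖ) (ω' : 𝒪ˣ →* ℂˣ)
    (h : T5PrincipalUnitFiltration.higherUnits ϖ (m + 1) ≤ ω'.ker) (Ψ : AddChar K ℂ) :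
    kudlaGaussSumSelfDual μ q ν hϖ ω' h Ψ =
      T5KudlaGaussSum.kudlaGaussSumZ μ hϖ ω' h Ψ ((ν + (m + 1) : ℕ) : ℤ) := by
  unfold kudlaGaussSumSelfDual T5KudlaGaussSum.kudlaGaussSumZ selfDualScaled
  rw [integral_smul_measure, ENNReal.toReal_ofReal (by positivity), Complex.real_smul,
    ← mul_assoc, ← Complex.ofReal_mul, sqrt_pow_add_mul_inv_sqrt_pow hq, ← hcard]

/-- The same with `q = |𝒪/𝔭|`: the cardinality hypothesis is `T5DVRQuotientCard`'s
`|𝒪/𝔭^{m+1}| = |𝒪/𝔭|^{m+1}`. -/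
theorem kudlaGaussSumSelfDual_eq_of_residueField [Finite (𝒪 ⧸ span {ϖ})] (ν : ℕ)
    [Fintype (𝒪 ⧸ span {ϖ ^ (m + 1)})] (hϖ : Irreducible ϖ) (ω' : 𝒪ˣ →* ℂˣ)
    (h : T5PrincipalUnitFiltration.higherUnits ϖ (m + 1) ≤ ω'.ker) (Ψ : AddChar K ℂ) :
    kudlaGaussSumSelfDual μ (Nat.card (𝒪 ⧸ span {ϖ}) : ℝ) ν hϖ ω' h Ψ =
      T5KudlaGaussSum.kudlaGaussSumZ μ hϖ ω' h Ψ ((ν + (m + 1) : ℕ) : ℤ) := by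
  refine kudlaGaussSumSelfDual_eq μ (by exact_mod_cast Nat.card_pos) ν ?_ hϖ ω' h Ψ
  rw [← Nat.card_eq_fintype_card, T5DVRQuotientCard.card_quot_span_pow hϖ]
  push_cast
  rfl

section Identities

variable [MeasurableAdd 𝒪] [μ.IsAddLeftInvariant] [IsProbabilityMeasure μ] [IsFractionRing 𝒪 K]

/-- `𝔤(ω, ψ)` with the self-dual measure is the normalised finite Gauss sum `gNorm` of the
descended characters (`ψ` of conductor `𝔭^{−ν}`: trivial on `ϖ^{−ν}𝒪`). -/
theorem kudlaGaussSumSelfDual_eq_gNorm (hμ : MeasurableSet ((span {ϖ ^ (m + 1)} : Ideal 𝒪) : Set 𝒪))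
    {q : ℝ} (hq : 0 < q) (ν : ℕ) [Fintype (𝒪 ⧸ span {ϖ ^ (m + 1)})]
    (hcard : (Fintype.card (𝒪 ⧸ span {ϖ ^ (m + 1)}) : ℝ) = q ^ (m + 1))
    (hϖ : Irreducible ϖ) (ω' : 𝒪ˣ →* ℂˣ)
    (h : T5PrincipalUnitFiltration.higherUnits ϖ (m + 1) ≤ ω'.ker) (Ψ : AddChar K ℂ)
    (hΨ : ∀ x : 𝒪, Ψ (algebraMap 𝒪 K x *
      algebraMap 𝒪 K ϖ ^ (((m + 1 : ℕ) : ℤ) - ((ν + (m + 1) : ℕ) : ℤ))) = 1) :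
    kudlaGaussSumSelfDual μ q ν hϖ ω' h Ψ =
      T5LocalRingGaussSum.gNorm (T5CharacterDescent.descendChar hϖ ω' h)
        (T5ShiftCharacter.shiftCharZ m hϖ Ψ ((ν + (m + 1) : ℕ) : ℤ) hΨ) := by
  rw [kudlaGaussSumSelfDual_eq μ hq ν hcard hϖ ω' h Ψ]
  exact T5KudlaGaussSum.kudlaGaussSumZ_eq_gNorm μ hμ hϖ ω' h Ψ _ hΨ

/-- **(T1) for the self-dual normalisation at every `ν`**: `𝔤(ω, ψ) 𝔤(ω⁻¹, ψ) = ω(−1)` —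
`ω'` of conductor exactly `𝔭^{m+1}`, `ψ` of conductor exactly `𝔭^{−ν}` (trivial on
`ϖ^{−ν}𝒪`, non-trivial on `ϖ^{−ν−1}𝒪`), `|𝒪/𝔭^{m+1}| = q^{m+1}`. -/
theorem kudlaGaussSumSelfDual_mul_kudlaGaussSumSelfDual_inv
    (hμ : MeasurableSet ((span {ϖ ^ (m + 1)} : Ideal 𝒪) : Set 𝒪))
    {q : ℝ} (hq : 0 < q) (ν : ℕ) [Fintype (𝒪 ⧸ span {ϖ ^ (m + 1)})]
    (hcard : (Fintype.card (𝒪 ⧸ span {ϖ ^ (m + 1)}) : ℝ) = q ^ (m + 1))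
    (hϖ : Irreducible ϖ) {ω' : 𝒪ˣ →* ℂˣ}
    (hex : ∃ n, T5PrincipalUnitFiltration.higherUnits ϖ n ≤ ω'.ker)
    (hω : T5ConductorArithmetic.conductor (T5PrincipalUnitFiltration.higherUnits ϖ) ω' = m + 1)
    (h₁ : T5PrincipalUnitFiltration.higherUnits ϖ (m + 1) ≤ ω'.ker)
    (h₂ : T5PrincipalUnitFiltration.higherUnits ϖ (m + 1) ≤ ω'⁻¹.ker)
    (Ψ : AddChar K ℂ)
    (hΨ : ∀ x : 𝒪, Ψ (algebraMap 𝒪 K x *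
      algebraMap 𝒪 K ϖ ^ (((m + 1 : ℕ) : ℤ) - ((ν + (m + 1) : ℕ) : ℤ))) = 1)
    {y : 𝒪} (hy : Ψ (algebraMap 𝒪 K y *
      algebraMap 𝒪 K ϖ ^ ((m : ℤ) - ((ν + (m + 1) : ℕ) : ℤ))) ≠ 1) :
    kudlaGaussSumSelfDual μ q ν hϖ ω' h₁ Ψ * kudlaGaussSumSelfDual μ q ν hϖ ω'⁻¹ h₂ Ψ =
      (ω' (-1) : ℂ) := by
  rw [kudlaGaussSumSelfDual_eq μ hq ν hcard hϖ ω' h₁ Ψ,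
    kudlaGaussSumSelfDual_eq μ hq ν hcard hϖ ω'⁻¹ h₂ Ψ]
  exact T5KudlaGaussSum.kudlaGaussSumZ_mul_kudlaGaussSumZ_inv μ hμ hϖ hex hω Ψ _ hΨ hy

end Identities

end Summit.Ventures.HodgeRepro2.T5SelfDualGaussSum
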